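import Summits.QuantumFields.BalabanUV.Beta.FP.NestedDressingDescentLeg
import Summits.QuantumFields.BalabanUV.Beta.FP.PerfectColumnSemigroup
import Summits.QuantumFields.BalabanUV.Beta.FP.StepLawKHolds

/-!
# Road FP, W-ORACLE-K §11 row SPLIT (iii) «N-DESC» through the COMPOSITE perfect column (leaf-06 g15)

`NestedDressingDescentLeg` (p301692 ∕ p302158) proved the nested projector's DESCENT through the ONE-step perfect resolvent's multiplier columns:
`[Π̂_{m+1}·KPerf 1](x, Lc•y″; inl a, inr μ) = [Π̂₁·KPerf 1](…) − (Lc⁴)⁻¹ · (grad (liftBlk Lc (σ^{(m)} δ_{(μ,y″)})))_a(x)` — from the finite-`j` law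
`𝒬̄ ℋ_{(j,1)} = c_j · δ` (`qbar_KTot_one_inr`) and `j → ∞`.

This file reads the same descent on the COMPOSITE perfect column `KPerf (m+1)`'s multiplier legs at the points `Lc^{m+1}•z′` of the `(m+1)`-st lattice — the
column leaf-02's G-slot `G_N = Π̂_Nᵀ·KPerf_N·Π̂_N` actually carries (memo §11 (11b) (iii), `PerfectSecondOrderTablesNested`):

* §1 `qbar_KPerf_one_inr` — the PERFECT one-step `𝒬̄ℋ = δ` law: `qbar Lc ((κ, q) ↦ KPerf 1 q (Lc•y″) (inl κ) (inr μ)) = (Lc⁴)⁻¹ • δ_{(μ,y″)}` (the `j → ∞` limit of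
  `qbar_KTot_one_inr`, whose coefficient is `j`-free in road units by `coeff_road_units`).
* §2 `qbar_KPerf_succ_inr` — the COMPOSITE law: `qbar Lc ((κ, q) ↦ KPerf (m+1) q (Lc^{m+1}•z′) (inl κ) (inr μ)) = (Lc⁴)⁻¹ • ((κ, Y) ↦ KPerf m Y (Lc^m•z′) (inl κ) (inr μ))`
  — the block average of the `(m+1)`-fold perfect multiplier column IS the `m`-fold perfect multiplier column one lattice up, by leaf-02's perfect column
  semigroup `PerfectColumnSemigroup.kPerf_column_semigroup` (`ℋ_{Lc^{m+1}} = ℋ_{Lc} ∘ lift(ℋ_{Lc^m})`), §1, and Fubini for the finite contour sum against the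
  `w′`-series (summable by the decay of `KPerf 1`, `StepLawKHolds.exists_decays_KPerf_holds`, and `PerfectTelescopingLimit.summable_exp_dilate`).
* §3 `dressNestLeft_KPerf_succ_succ_inr_eq` — N-DESC ON THE COMPOSITE COLUMN: for `m ≥ 1`, in-block root `r`, depth `n`,
  `[Π̂_{n+1}·KPerf (m+1)](x, Lc^{m+1}•z′; inl a, inr μ) = [Π̂₁·KPerf (m+1)](…) − (Lc⁴)⁻¹ · (grad (liftBlk Lc (σ^{(n)} ((κ, Y) ↦ KPerf m Y (Lc^m•z′) (inl κ) (inr μ)))))_a(x)`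
  — `NestedDressingDescentLeg.dressNestLeft_succ_eq_one_sub_of_qbar` fed with §2: the nested projector descends through the composite minimiser column to the
  coarse nested gauge of the `m`-FOLD PERFECT COLUMN (at `m = 0` this is `dressNestLeft_KPerf_one_succ_inr_eq`, the coarse datum being `δ`).

HONEST: [our proof] one `j → ∞` limit of a landed finite-`j` identity, one Fubini, one substitution; 0 estimates beyond the landed decay letters; 0∕4 row-D1
binders; NOT SLOT, NOT (SDF), NOT D1, NOT BetaPertH, NOT continuum, NOT Clay.  HONEST DEPENDENCY: continuum YM on T⁴ ⇐ BetaPertH ∧ nine spine estimates (0/9 proved);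
BetaPertH ⇐ (D1) ∧ (D4) ∧ CAP+tail; G-an2-4 gates asym, D1 and NE2/3/4.
-/

noncomputable section

namespace Summit.QuantumFields.BalabanUV.Beta.FP.NestedDressingDescentComposite

open Finset Filter Topology
open scoped BigOperators
open Literature.MathematicalPhysics.QuantumFieldTheory
open Literature.MathematicalPhysics.QuantumFieldTheory.Balaban1983to89
open Literature.MathematicalPhysics.QuantumFieldTheory.Balaban1983to89.Beta
open B12Sec2to5 (l1 l1_nonneg)
open AffineAveraging (Form0 Form1 Site box toSite unitVec contourSum)
open AveragingContours (grad)
open ExpKernelCalculus (MKer comp Decays l1_sub_symm)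
open OneStepResolventKernel (Fib)
open Summit.QuantumFields.BalabanUV.Beta.TameKernelCalculus (trK)
open Summit.QuantumFields.BalabanUV.Beta.HessKerDressedUnits (unitK)
open Summit.QuantumFields.BalabanUV.Beta.GAN24.CombesThomas (sfStep smStep)
open Summit.QuantumFields.BalabanUV.Beta.GAN24.RealRateKMHolds (tendsto_KTot_KPerf_holds)
open Summit.QuantumFields.BalabanUV.Beta.SymmetrisedDressingMatrix (bondIndR bondIndR_apply)
open Summit.QuantumFields.BalabanUV.Beta.SymmetrisedDressingKernel (piKSymBm)
open Summit.QuantumFields.BalabanUV.Beta.FP.PerfectObjects (KTot)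
open Summit.QuantumFields.BalabanUV.Beta.FP.PerfectObjectsT (KPerf)
open Summit.QuantumFields.BalabanUV.Beta.FP.PerfectTelescopingLimit (summable_exp_dilate)
open Summit.QuantumFields.BalabanUV.Beta.FP.PerfectColumnSemigroup (kPerf_column_semigroup abs_le_of_decays)
open Summit.QuantumFields.BalabanUV.Beta.FP.StepLawKHolds (exists_decays_KPerf_holds)
open Summit.QuantumFields.BalabanUV.Beta.FP.NestedDressingProjector (qbar liftBlk symNestGaugeAt)
open Summit.QuantumFields.BalabanUV.Beta.FP.NestedDressingKernel (piKSymNest piKSymNest_one)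
open Summit.QuantumFields.BalabanUV.Beta.FP.NestedDressingDescentLeg (dressNestLeft_succ_eq_one_sub_of_qbar qbar_KTot_one_inr coeff_road_units)

variable (Lc : ℕ) [NeZero Lc]

/-! ## §1 The perfect one-step `𝒬̄ℋ = δ` law -/

/-- [our proof] **THE PERFECT ONE-STEP RESOLVENT'S MULTIPLIER COLUMN AVERAGES TO THE COARSE BOND INDICATOR** (`d + 1 = 4`, `Lc ≥ 2`, road units):
`qbar Lc ((κ, q) ↦ KPerf 1 q (Lc•y″) (inl κ) (inr μ)) = (Lc⁴)⁻¹ • δ_{(μ,y″)}` — the entrywise `j → ∞` limit (`RealRateKMHolds.tendsto_KTot_KPerf_holds`, finite contour sums) of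
`NestedDressingDescentLeg.qbar_KTot_one_inr`, whose coefficient `uf·um·((Lc^j)^{d+2})⁻¹·(Lc^{d+1})⁻¹` is the `j`-free `(Lc⁴)⁻¹` in road units (`coeff_road_units`). -/
theorem qbar_KPerf_one_inr (hLc : 2 ≤ Lc) (y'' : Site (3 + 1)) (μ : Fin (3 + 1)) :
    qbar Lc (fun κ q => KPerf (d := 3) Lc (sfStep Lc) (smStep 3 Lc) 1 q ((Lc : ℤ) • y'') (Sum.inl κ) (Sum.inr μ))
      = (((Lc : ℝ) ^ (3 + 1)))⁻¹ • bondIndR μ y'' := by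
  have hLc1 : 1 ≤ Lc := by omega
  funext κ Y
  have hj : ∀ j : ℕ, qbar Lc (fun κ q => unitK (sfStep Lc j) (smStep 3 Lc j) (KTot (d := 3) (Lc ^ (j + 1)) (Lc ^ j)) q ((Lc : ℤ) • y'')
      (Sum.inl κ) (Sum.inr μ)) κ Y = ((((Lc : ℝ) ^ (3 + 1)))⁻¹ • bondIndR μ y'') κ Y := fun j => by
    rw [qbar_KTot_one_inr Lc hLc1 j, coeff_road_units Lc hLc1 j]
  have tL : Tendsto (fun j : ℕ => qbar Lc (fun κ q => unitK (sfStep Lc j) (smStep 3 Lc j) (KTot (d := 3) (Lc ^ (j + 1)) (Lc ^ j)) q ((Lc : ℤ) • y'')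
      (Sum.inl κ) (Sum.inr μ)) κ Y) atTop
      (𝓝 (qbar Lc (fun κ q => KPerf (d := 3) Lc (sfStep Lc) (smStep 3 Lc) 1 q ((Lc : ℤ) • y'') (Sum.inl κ) (Sum.inr μ)) κ Y)) := by
    simp only [qbar, contourSum]
    exact (tendsto_finsetSum _ fun b _ => tendsto_finsetSum _ fun s _ =>
      tendsto_KTot_KPerf_holds hLc (m := 1) le_rfl _ _ _ _).const_mul _
  exact tendsto_nhds_unique tL (tendsto_const_nhds.congr fun j => (hj j).symm)

/-- [our proof] §1 read as a finite contour sum: `Σ_{b ∈ box} Σ_{s < Lc} KPerf 1 (Lc•Y + b + s•e_κ) (Lc•w′) (inl κ) (inr l″) = [κ = l″ ∧ Y = w′]`. -/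
theorem contourSum_KPerf_one_inr (hLc : 2 ≤ Lc) (w' Y : Site (3 + 1)) (κ l'' : Fin (3 + 1)) :
    contourSum Lc (fun κ q => KPerf (d := 3) Lc (sfStep Lc) (smStep 3 Lc) 1 q ((Lc : ℤ) • w') (Sum.inl κ) (Sum.inr l'')) κ Y
      = if κ = l'' ∧ Y = w' then 1 else 0 := by
  have hL : (((Lc : ℝ) ^ (3 + 1)))⁻¹ ≠ 0 := inv_ne_zero (pow_ne_zero _ (by exact_mod_cast (show Lc ≠ 0 by omega)))
  have h := congrFun (congrFun (qbar_KPerf_one_inr Lc hLc w' l'') κ) Y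
  simp only [qbar, Pi.smul_apply, smul_eq_mul] at h
  rw [← bondIndR_apply]
  exact mul_left_cancel₀ hL h

/-! ## §2 The composite law: the block average of the `(m+1)`-fold perfect multiplier column is the `m`-fold one, one lattice up -/

/-- [folklore] The `w′`-series of the perfect column semigroup is summable: `KPerf 1` decays from the coarse point `Lc•w′` (`StepLawKHolds.exists_decays_KPerf_holds`,
`PerfectTelescopingLimit.summable_exp_dilate`) and `KPerf m` is bounded. -/
theorem summable_KPerf_one_mul_KPerf (hLc : 2 ≤ Lc) {m : ℕ} (hm : 1 ≤ m) (q z' : Site (3 + 1)) (κ l'' μ : Fin (3 + 1)) :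
    Summable fun w' : Site (3 + 1) =>
      KPerf (d := 3) Lc (sfStep Lc) (smStep 3 Lc) 1 q ((Lc : ℤ) • w') (Sum.inl κ) (Sum.inr l'')
        * KPerf (d := 3) Lc (sfStep Lc) (smStep 3 Lc) m w' (((Lc ^ m : ℕ) : ℤ) • z') (Sum.inl l'') (Sum.inr μ) := by
  obtain ⟨C₁, δ₁, hδ₁, hD₁⟩ := exists_decays_KPerf_holds hLc (le_refl 1)
  obtain ⟨Cm, δm, hδm, hDm⟩ := exists_decays_KPerf_holds hLc hm
  have hC₁ : 0 ≤ C₁ := hD₁.nonneg (Sum.inl 0)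
  refine Summable.of_norm_bounded (((summable_exp_dilate (d := 3) Lc hδ₁ q).mul_left C₁).mul_right Cm) (fun w' => ?_)
  rw [Real.norm_eq_abs, abs_mul]
  refine mul_le_mul ?_ (abs_le_of_decays hDm hδm.le _ _ _ _) (abs_nonneg _) (by positivity)
  have h := hD₁ q ((Lc : ℤ) • w') (Sum.inl κ) (Sum.inr l'')
  rwa [l1_sub_symm] at h

/-- [our proof] **THE COMPOSITE `𝒬̄`-LAW** (`d + 1 = 4`, `Lc ≥ 2`, `m ≥ 1`, road units): on the multiplier legs at the points `Lc^{m+1}•z′` of the `(m+1)`-st lattice,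
`qbar Lc ((κ, q) ↦ KPerf (m+1) q (Lc^{m+1}•z′) (inl κ) (inr μ)) = (Lc⁴)⁻¹ • ((κ, Y) ↦ KPerf m Y (Lc^m•z′) (inl κ) (inr μ))` — the block average over the fine
`Lc`-blocks of the `(m+1)`-fold perfect multiplier column is `(Lc⁴)⁻¹` times the `m`-fold perfect multiplier column read on the `Lc`-lattice.  Proof:
`kPerf_column_semigroup` (`KPerf (m+1) q (Lc^{m+1}•z′; κ, μ) = Σ'_{w′} Σ_{l″} KPerf 1 q (Lc•w′; κ, l″) · KPerf m w′ (Lc^m•z′; l″, μ)`), Fubini of the finite contour sum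
against the summable `w′`-series, §1 (`contourSum_KPerf_one_inr`: the inner contour sum is the delta `[κ = l″ ∧ Y = w′]`), and the collapse of the `w′`-series. -/
theorem qbar_KPerf_succ_inr (hLc : 2 ≤ Lc) {m : ℕ} (hm : 1 ≤ m) (z' : Site (3 + 1)) (μ : Fin (3 + 1)) :
    qbar Lc (fun κ q => KPerf (d := 3) Lc (sfStep Lc) (smStep 3 Lc) (m + 1) q (((Lc ^ (m + 1) : ℕ) : ℤ) • z') (Sum.inl κ) (Sum.inr μ))
      = (((Lc : ℝ) ^ (3 + 1)))⁻¹ • fun κ Y => KPerf (d := 3) Lc (sfStep Lc) (smStep 3 Lc) m Y (((Lc ^ m : ℕ) : ℤ) • z') (Sum.inl κ) (Sum.inr μ) := by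
  funext κ Y
  simp only [qbar, Pi.smul_apply, smul_eq_mul]
  congr 1
  -- the summands of the column semigroup, per fine point `q` and intermediate bond `(l″, w′)`
  set F : Site (3 + 1) → Fin (3 + 1) → Site (3 + 1) → ℝ := fun q l'' w' =>
    KPerf (d := 3) Lc (sfStep Lc) (smStep 3 Lc) 1 q ((Lc : ℤ) • w') (Sum.inl κ) (Sum.inr l'')
      * KPerf (d := 3) Lc (sfStep Lc) (smStep 3 Lc) m w' (((Lc ^ m : ℕ) : ℤ) • z') (Sum.inl l'') (Sum.inr μ) with hF
  have hFs : ∀ q l'', Summable (F q l'') := fun q l'' => summable_KPerf_one_mul_KPerf Lc hLc hm q z' κ l'' μ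
  -- (i) expand every summand of the contour sum through the semigroup, with the finite `l″`-sum outside the series
  have hcol : ∀ q : Site (3 + 1), KPerf (d := 3) Lc (sfStep Lc) (smStep 3 Lc) (m + 1) q (((Lc ^ (m + 1) : ℕ) : ℤ) • z') (Sum.inl κ) (Sum.inr μ)
      = ∑ l'' : Fin (3 + 1), ∑' w' : Site (3 + 1), F q l'' w' := fun q => by
    rw [kPerf_column_semigroup Lc hLc hm κ μ q z', Summable.tsum_finsetSum (fun l'' _ => hFs q l'')]
  have hL : contourSum Lc (fun κ q => KPerf (d := 3) Lc (sfStep Lc) (smStep 3 Lc) (m + 1) q (((Lc ^ (m + 1) : ℕ) : ℤ) • z') (Sum.inl κ) (Sum.inr μ)) κ Y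
      = ∑ l'' : Fin (3 + 1), ∑' w' : Site (3 + 1), contourSum Lc (fun κ q => F q l'' w') κ Y := by
    symm
    calc ∑ l'' : Fin (3 + 1), ∑' w' : Site (3 + 1), contourSum Lc (fun κ q => F q l'' w') κ Y
        = ∑ l'' : Fin (3 + 1), ∑ b ∈ box (3 + 1) Lc, ∑ s ∈ Finset.range Lc,
            ∑' w' : Site (3 + 1), F ((Lc : ℤ) • Y + toSite b + (s : ℤ) • unitVec κ) l'' w' := by
          refine Finset.sum_congr rfl fun l'' _ => ?_
          simp only [contourSum]
          rw [Summable.tsum_finsetSum (fun b _ => summable_sum fun s _ => hFs _ l'')]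
          exact Finset.sum_congr rfl fun b _ => Summable.tsum_finsetSum (fun s _ => hFs _ l'')
      _ = ∑ b ∈ box (3 + 1) Lc, ∑ s ∈ Finset.range Lc, ∑ l'' : Fin (3 + 1),
            ∑' w' : Site (3 + 1), F ((Lc : ℤ) • Y + toSite b + (s : ℤ) • unitVec κ) l'' w' :=
          Finset.sum_comm.trans (Finset.sum_congr rfl fun b _ => Finset.sum_comm)
      _ = contourSum Lc (fun κ q => KPerf (d := 3) Lc (sfStep Lc) (smStep 3 Lc) (m + 1) q (((Lc ^ (m + 1) : ℕ) : ℤ) • z') (Sum.inl κ) (Sum.inr μ)) κ Y := by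
          simp only [contourSum, hcol]
  -- (ii) the contour sum of `F · l″ w′` is the delta times the `m`-fold column (§1)
  have hδ : ∀ (l'' : Fin (3 + 1)) (w' : Site (3 + 1)), contourSum Lc (fun κ q => F q l'' w') κ Y
      = (if κ = l'' ∧ Y = w' then 1 else 0) * KPerf (d := 3) Lc (sfStep Lc) (smStep 3 Lc) m w' (((Lc ^ m : ℕ) : ℤ) • z') (Sum.inl l'') (Sum.inr μ) := by
    intro l'' w'
    rw [← contourSum_KPerf_one_inr Lc hLc w' Y κ l'']
    simp only [contourSum, hF, Finset.sum_mul]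
  -- (iii) collapse: the `w′`-series is supported at `w′ = Y`, the `l″`-sum at `l″ = κ`
  have hw : ∀ l'' : Fin (3 + 1), ∑' w' : Site (3 + 1), (if κ = l'' ∧ Y = w' then (1 : ℝ) else 0)
      * KPerf (d := 3) Lc (sfStep Lc) (smStep 3 Lc) m w' (((Lc ^ m : ℕ) : ℤ) • z') (Sum.inl l'') (Sum.inr μ)
      = (if κ = l'' then (1 : ℝ) else 0) * KPerf (d := 3) Lc (sfStep Lc) (smStep 3 Lc) m Y (((Lc ^ m : ℕ) : ℤ) • z') (Sum.inl l'') (Sum.inr μ) := by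
    intro l''
    rw [tsum_eq_single Y (fun w' hw' => by rw [if_neg (fun h => hw' h.2.symm), zero_mul])]
    simp only [and_true]
  rw [hL]
  calc ∑ l'' : Fin (3 + 1), ∑' w' : Site (3 + 1), contourSum Lc (fun κ q => F q l'' w') κ Y
      = ∑ l'' : Fin (3 + 1), ∑' w' : Site (3 + 1), (if κ = l'' ∧ Y = w' then (1 : ℝ) else 0)
          * KPerf (d := 3) Lc (sfStep Lc) (smStep 3 Lc) m w' (((Lc ^ m : ℕ) : ℤ) • z') (Sum.inl l'') (Sum.inr μ) :=
        Finset.sum_congr rfl fun l'' _ => tsum_congr (hδ l'')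
    _ = ∑ l'' : Fin (3 + 1), (if κ = l'' then (1 : ℝ) else 0)
          * KPerf (d := 3) Lc (sfStep Lc) (smStep 3 Lc) m Y (((Lc ^ m : ℕ) : ℤ) • z') (Sum.inl l'') (Sum.inr μ) :=
        Finset.sum_congr rfl fun l'' _ => hw l''
    _ = KPerf (d := 3) Lc (sfStep Lc) (smStep 3 Lc) m Y (((Lc ^ m : ℕ) : ℤ) • z') (Sum.inl κ) (Sum.inr μ) := by
        simp only [ite_mul, one_mul, zero_mul, Finset.sum_ite_eq, Finset.mem_univ, if_true]

/-! ## §3 N-DESC on the composite perfect column -/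

/-- [our proof] **SPLIT (iii) «N-DESC» ON THE COMPOSITE PERFECT COLUMN — UNCONDITIONAL** (`d + 1 = 4`, `Lc ≥ 2`, `m ≥ 1`, in-block root `r ∈ box 4 Lc`, every depth `n`,
road units): on the MULTIPLIER legs of the `(m+1)`-fold perfect resolvent at the points `Lc^{m+1}•z′`,
`[Π̂_{n+1}·KPerf (m+1)](x, Lc^{m+1}•z′; inl a, inr μ) = [Π̂₁·KPerf (m+1)](x, Lc^{m+1}•z′; inl a, inr μ) − (Lc⁴)⁻¹ · (grad (liftBlk Lc (σ^{(n)} H_m)))_a(x)`,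
`H_m := (κ, Y) ↦ KPerf m Y (Lc^m•z′) (inl κ) (inr μ)` the `m`-fold perfect multiplier column one lattice up (`Π̂_M := piKSymNest (toSite r) Lc M`,
`σ^{(n)} := symNestGaugeAt (toSite r) Lc n`): the nested projector descends through the composite minimiser column to the coarse nested gauge of the `m`-fold column
— `NestedDressingDescentLeg.dressNestLeft_succ_eq_one_sub_of_qbar` with §2.  (The `m = 0` reading, coarse datum `δ_{(μ,z′)}`, is `dressNestLeft_KPerf_one_succ_inr_eq`.) -/
theorem dressNestLeft_KPerf_succ_succ_inr_eq (hLc : 2 ≤ Lc) {r : Fin (3 + 1) → ℕ} (hr : r ∈ box (3 + 1) Lc) {m : ℕ} (hm : 1 ≤ m) (n : ℕ)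
    (x z' : Site (3 + 1)) (a μ : Fin (3 + 1)) :
    comp (trK (piKSymNest (toSite r) Lc (n + 1))) (KPerf (d := 3) Lc (sfStep Lc) (smStep 3 Lc) (m + 1)) x (((Lc ^ (m + 1) : ℕ) : ℤ) • z') (Sum.inl a) (Sum.inr μ)
      = comp (trK (piKSymNest (toSite r) Lc 1)) (KPerf (d := 3) Lc (sfStep Lc) (smStep 3 Lc) (m + 1)) x (((Lc ^ (m + 1) : ℕ) : ℤ) • z') (Sum.inl a) (Sum.inr μ)
        - (((Lc : ℝ) ^ (3 + 1)))⁻¹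
          * grad (liftBlk Lc (symNestGaugeAt (toSite r) Lc n
              (fun κ Y => KPerf (d := 3) Lc (sfStep Lc) (smStep 3 Lc) m Y (((Lc ^ m : ℕ) : ℤ) • z') (Sum.inl κ) (Sum.inr μ)))) a x :=
  dressNestLeft_succ_eq_one_sub_of_qbar (by omega) hr n _ _ _ (qbar_KPerf_succ_inr Lc hLc hm z' μ) x a

/-- [our proof] The same with an2's one-step kernel `piKSymBm` (the literal's `Π̂₁`, `piKSymNest_one`) on the right. -/
theorem dressNestLeft_KPerf_succ_succ_inr_eq_piKSymBm (hLc : 2 ≤ Lc) {r : Fin (3 + 1) → ℕ} (hr : r ∈ box (3 + 1) Lc) {m : ℕ} (hm : 1 ≤ m) (n : ℕ)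
    (x z' : Site (3 + 1)) (a μ : Fin (3 + 1)) :
    comp (trK (piKSymNest (toSite r) Lc (n + 1))) (KPerf (d := 3) Lc (sfStep Lc) (smStep 3 Lc) (m + 1)) x (((Lc ^ (m + 1) : ℕ) : ℤ) • z') (Sum.inl a) (Sum.inr μ)
      = comp (trK (piKSymBm (toSite r) Lc)) (KPerf (d := 3) Lc (sfStep Lc) (smStep 3 Lc) (m + 1)) x (((Lc ^ (m + 1) : ℕ) : ℤ) • z') (Sum.inl a) (Sum.inr μ)
        - (((Lc : ℝ) ^ (3 + 1)))⁻¹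
          * grad (liftBlk Lc (symNestGaugeAt (toSite r) Lc n
              (fun κ Y => KPerf (d := 3) Lc (sfStep Lc) (smStep 3 Lc) m Y (((Lc ^ m : ℕ) : ℤ) • z') (Sum.inl κ) (Sum.inr μ)))) a x := by
  rw [dressNestLeft_KPerf_succ_succ_inr_eq Lc hLc hr hm, piKSymNest_one]

end Summit.QuantumFields.BalabanUV.Beta.FP.NestedDressingDescentComposite

end
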